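import Literature.MathematicalPhysics.QuantumManyBody.BoseEinsteinCondensation
import Literature.Analysis.FluidPDE.TsaiMaximumPrinciple
import Mathlib.Analysis.InnerProductSpace.Laplacian
import Mathlib.Analysis.SpecialFunctions.Trigonometric.Bounds
import Mathlib.Analysis.SpecialFunctions.Trigonometric.Deriv
import Mathlib.Analysis.Calculus.ContDiff.WithLp

/-!
# Route `BECConjugateDomination`, crux `PuffFloor` (stmt-AtomisticToContinuum-11785),
# line `coupling-slope-pocket`: the interior maximum principle (stub S7d `stub_maxPrinciple`)

Supports (does not close) stmt-AtomisticToContinuum-11785. The inner half of the coreless pair-count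
bound controls a `C²` subsolution `G ≥ 0` of `Δ + λ` (`λ = O(ρ)` small) INSIDE a ball of `ℝ³` by its values
ON the sphere. This file proves that generalised interior maximum principle with an absolute constant
(`Cmp = 8`):

* from the tree (`Literature/Analysis/FluidPDE/TsaiMaximumPrinciple.lean`, Gilbarg–Trudinger §3.1) we use
  `Literature.Analysis.FluidPDE.laplacian_nonpos_of_isLocalMax` (`Δφ ≤ 0` at a local maximum of a `C²`
  function) and `Literature.Analysis.FluidPDE.deriv_deriv_comp_line` (`(d/dt)² f(y + tv)|₀ = D²f(y)(v,v)`);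
* `PuffFloorMaxPrinciple.laplacian_sub_const_mul` — `Δ(u − Mw) = Δu − MΔw` for `C²` functions;
* the cosine barrier `w(y) = ∏ₐ cos((yₐ − x₀ₐ)/R)` on `ℝ³`: `1/8 ≤ w ≤ 1` on the closed ball `B̄(x₀,R)`
  and `Δw = −(3/R²) w`;
* `stub_maxPrinciple` — if `u ∈ C²(ℝ³)`, `0 ≤ λ`, `λR² ≤ 1`, `Δu + λu ≥ 0` on `B(x₀,R)` and `u ≤ B` on the
  sphere (`B ≥ 0`), then `u ≤ 8B` on `B̄(x₀,R)`: the quotient `u/w` attains its maximum `M` on the compact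
  closed ball; at an interior maximiser `u − Mw` has a local maximum, so `Δ(u − Mw) ≤ 0` there, and
  `0 ≤ Δu + λu ≤ M w (λ − 3/R²)` forces `M ≤ 0`; at a boundary maximiser `M ≤ B / w ≤ 8B`.

References: ProtterWeinberger1967 Ch. 2 Thm 10; GilbargTrudinger2001 Cor. 3.2 (generalised maximum
principle via a positive strict supersolution). Pure finite-dimensional calculus over Mathlib.
-/

noncomputable section

namespace Summit.AtomisticToContinuum.BoseEinsteinCondensation.Theorems

open Filter Topology
open scoped BigOperators Laplacian
open Literature.MathematicalPhysics.QuantumManyBody.BoseGas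

namespace PuffFloorMaxPrinciple

/-! ## Linearity of the Laplacian -/

section InnerProduct

variable {E : Type*} [NormedAddCommGroup E] [InnerProductSpace ℝ E] [FiniteDimensional ℝ E]

/-- Linearity of the Laplacian in the form used below: `Δ(u − M w) = Δu − M Δw` for `C²` functions.
[folklore] -/
theorem laplacian_sub_const_mul {u w : E → ℝ} (hu : ContDiff ℝ 2 u) (hw : ContDiff ℝ 2 w)
    (M : ℝ) (y : E) :
    (Δ fun z => u z - M * w z) y = (Δ u) y - M * (Δ w) y := by
  have h1 : (fun z => u z - M * w z) = u - M • w := by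
    ext z
    simp
  have h2 : ContDiff ℝ 2 (M • w) := hw.const_smul M
  rw [h1, hu.contDiffAt.laplacian_sub h2.contDiffAt,
    InnerProductSpace.laplacian_smul M hw.contDiffAt, smul_eq_mul]

end InnerProduct

/-! ## The cosine barrier on `ℝ³` -/

/-- The barrier `w(y) = ∏ₐ cos((yₐ − x₀ₐ)/R)` is smooth. [folklore] -/
theorem barrier_contDiff (x₀ : Space) (R : ℝ) {n : WithTop ℕ∞} :
    ContDiff ℝ n (fun y : Space => ∏ a, Real.cos ((y a - x₀ a) / R)) := by
  fun_prop

/-- `w ≤ 1` everywhere (each factor has absolute value `≤ 1`). [folklore] -/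
theorem barrier_le_one (x₀ : Space) (R : ℝ) (y : Space) :
    (∏ a, Real.cos ((y a - x₀ a) / R)) ≤ 1 := by
  refine (le_abs_self _).trans ?_
  rw [Finset.abs_prod]
  exact Finset.prod_le_one (fun _ _ => abs_nonneg _) fun _ _ => Real.abs_cos_le_one _

/-- On the closed ball `B̄(x₀, R)` every coordinate offset is at most `R`, so each factor is
`cos θ ≥ 1 − θ²/2 ≥ 1/2` (`Real.one_sub_sq_div_two_le_cos`) and `w ≥ 1/8`. [folklore] -/
theorem barrier_ge (x₀ : Space) {R : ℝ} (hR : 0 < R) (y : Space) (hy : y ∈ Metric.closedBall x₀ R) :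
    (1 / 8 : ℝ) ≤ ∏ a, Real.cos ((y a - x₀ a) / R) := by
  have hcos : ∀ a, (1 / 2 : ℝ) ≤ Real.cos ((y a - x₀ a) / R) := by
    intro a
    have h1 : |y a - x₀ a| ≤ R := by
      have := PiLp.dist_apply_le y x₀ a
      rw [Real.dist_eq] at this
      exact this.trans (Metric.mem_closedBall.1 hy)
    have h2 : |(y a - x₀ a) / R| ≤ 1 := by
      rw [abs_div, abs_of_pos hR, div_le_one hR]
      exact h1
    have h3 : ((y a - x₀ a) / R) ^ 2 ≤ 1 := (sq_le_one_iff_abs_le_one _).2 h2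
    linarith [Real.one_sub_sq_div_two_le_cos (x := (y a - x₀ a) / R)]
  calc (1 / 8 : ℝ) = ∏ _a : Fin 3, (1 / 2 : ℝ) := by norm_num [Finset.prod_const]
    _ ≤ ∏ a, Real.cos ((y a - x₀ a) / R) :=
        Finset.prod_le_prod (fun _ _ => by norm_num) fun a _ => hcos a

/-- Restriction of the barrier to the coordinate line through `y` along `eᵢ`: only the `i`-th factor
moves. [folklore] -/
theorem barrier_line (x₀ y : Space) (R : ℝ) (i : Fin 3) (t : ℝ) :
    (∏ a, Real.cos (((y + t • EuclideanSpace.single i (1 : ℝ)) a - x₀ a) / R)) =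
      Real.cos ((y i + t - x₀ i) / R) * ∏ a ∈ Finset.univ.erase i, Real.cos ((y a - x₀ a) / R) := by
  rw [← Finset.mul_prod_erase Finset.univ _ (Finset.mem_univ i)]
  congr 1
  · simp
  · refine Finset.prod_congr rfl fun a ha => ?_
    have hai : a ≠ i := Finset.ne_of_mem_erase ha
    simp [hai]

/-- Second derivative of the restricted barrier (one moving factor, `c = yᵢ − x₀ᵢ`, `P` the product of the
frozen factors): `(t ↦ cos((c + t)/R) · P)''(0) = −(1/R²) · cos(c/R) · P`. [folklore] -/
theorem barrier_line_deriv_deriv (c R P : ℝ) :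
    deriv (deriv fun t : ℝ => Real.cos ((c + t) / R) * P) 0 = -(1 / R ^ 2) * (Real.cos (c / R) * P) := by
  have h1 : ∀ t, HasDerivAt (fun t : ℝ => Real.cos ((c + t) / R) * P)
      (-Real.sin ((c + t) / R) * (1 / R) * P) t := fun t =>
    (((hasDerivAt_id t).const_add c).div_const R).cos.mul_const P
  have h1' : deriv (fun t : ℝ => Real.cos ((c + t) / R) * P) =
      fun t => -Real.sin ((c + t) / R) * (1 / R) * P := funext fun t => (h1 t).deriv
  have h2 : HasDerivAt (fun t : ℝ => -Real.sin ((c + t) / R) * (1 / R) * P)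
      (-(Real.cos ((c + 0) / R) * (1 / R)) * (1 / R) * P) 0 :=
    ((((hasDerivAt_id (0 : ℝ)).const_add c).div_const R).sin.neg.mul_const (1 / R)).mul_const P
  rw [h1', h2.deriv, add_zero]
  ring

/-- **`Δw = −(3/R²) w`** for the cosine barrier on `ℝ³`. [folklore] -/
theorem barrier_laplacian (x₀ : Space) (R : ℝ) (y : Space) :
    (Δ fun y : Space => ∏ a, Real.cos ((y a - x₀ a) / R)) y =
      -(3 / R ^ 2) * ∏ a, Real.cos ((y a - x₀ a) / R) := by
  rw [InnerProductSpace.laplacian_eq_iteratedFDeriv_orthonormalBasis _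
    (EuclideanSpace.basisFun (Fin 3) ℝ)]
  have hw : ContDiff ℝ 2 (fun y : Space => ∏ a, Real.cos ((y a - x₀ a) / R)) := barrier_contDiff x₀ R
  have key : ∀ i, iteratedFDeriv ℝ 2 (fun y : Space => ∏ a, Real.cos ((y a - x₀ a) / R)) y
      ![EuclideanSpace.basisFun (Fin 3) ℝ i, EuclideanSpace.basisFun (Fin 3) ℝ i] =
      -(1 / R ^ 2) * ∏ a, Real.cos ((y a - x₀ a) / R) := by
    intro i
    rw [← Literature.Analysis.FluidPDE.deriv_deriv_comp_line hw, EuclideanSpace.basisFun_apply]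
    simp only [barrier_line]
    have hre : (fun t : ℝ => Real.cos ((y i + t - x₀ i) / R) *
        ∏ a ∈ Finset.univ.erase i, Real.cos ((y a - x₀ a) / R)) =
        fun t : ℝ => Real.cos (((y i - x₀ i) + t) / R) *
          ∏ a ∈ Finset.univ.erase i, Real.cos ((y a - x₀ a) / R) := by
      funext t
      rw [show y i + t - x₀ i = (y i - x₀ i) + t by ring]
    rw [hre, barrier_line_deriv_deriv, Finset.mul_prod_erase Finset.univ
      (fun a => Real.cos ((y a - x₀ a) / R)) (Finset.mem_univ i)]
  simp only [key, Finset.sum_const, Finset.card_univ, Fintype.card_fin, nsmul_eq_mul]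
  push_cast
  ring

end PuffFloorMaxPrinciple

open PuffFloorMaxPrinciple in
/-- **S7d `stub_maxPrinciple`** (generalised interior maximum principle on a ball of `ℝ³`, absolute
constant `Cmp = 8`). If `u ∈ C²(ℝ³)`, `0 ≤ λ`, `λR² ≤ 1`, `Δu + λu ≥ 0` on the open ball `B(x₀,R)` and
`u ≤ B` on the sphere `|x − x₀| = R` with `B ≥ 0`, then `u ≤ 8B` on the closed ball. Proof: with the
barrier `w(y) = ∏ₐ cos((yₐ − x₀ₐ)/R)` (`1/8 ≤ w ≤ 1` on the closed ball, `Δw = −(3/R²)w`, `3/R² > λ`), the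
quotient `u/w` attains its maximum `M` on the compact closed ball at some `y*`; if `y*` is interior,
`u − Mw ≤ 0 = (u − Mw)(y*)` near `y*`, so `Δ(u − Mw)(y*) ≤ 0`, i.e. `Δu ≤ −(3/R²) M w` at `y*`, and
`0 ≤ Δu + λu = Δu + λMw ≤ Mw(λ − 3/R²)` forces `M ≤ 0`; if `y*` is on the sphere, `Mw(y*) = u(y*) ≤ B`
gives `M ≤ 8B`. Finally `u = (u/w) w ≤ max(M,0) ≤ 8B` on the closed ball.
[ProtterWeinberger1967 Ch. 2 Thm 10; GilbargTrudinger2001 Cor. 3.2] -/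
theorem stub_maxPrinciple :
    ∃ Cmp : ℝ, 0 < Cmp ∧ ∀ (u : Space → ℝ) (x₀ : Space) (R lam B : ℝ),
      0 < R → 0 ≤ lam → lam * R ^ 2 ≤ 1 → 0 ≤ B → ContDiff ℝ 2 u →
      (∀ x ∈ Metric.ball x₀ R, 0 ≤ (Δ u) x + lam * u x) →
      (∀ x ∈ Metric.sphere x₀ R, u x ≤ B) →
      ∀ x ∈ Metric.closedBall x₀ R, u x ≤ Cmp * B := by
  refine ⟨8, by norm_num, ?_⟩
  intro u x₀ R lam B hR _hlam hlamR hB hu hsub hbdry x hx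
  -- the barrier and its properties
  set w : Space → ℝ := fun y => ∏ a, Real.cos ((y a - x₀ a) / R) with hw_def
  have hw_smooth : ContDiff ℝ 2 w := barrier_contDiff x₀ R
  have hw_lap : ∀ y, (Δ w) y = -(3 / R ^ 2) * w y := barrier_laplacian x₀ R
  have hw_lower : ∀ y ∈ Metric.closedBall x₀ R, (1 / 8 : ℝ) ≤ w y := barrier_ge x₀ hR
  have hw_le_one : ∀ y, w y ≤ 1 := barrier_le_one x₀ R
  have hw_pos : ∀ y ∈ Metric.closedBall x₀ R, 0 < w y := fun y hy => by
    linarith [hw_lower y hy]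
  -- the quotient `u / w` attains its maximum on the compact closed ball
  set K := Metric.closedBall x₀ R with hK_def
  have hKc : IsCompact K := isCompact_closedBall x₀ R
  have hKne : K.Nonempty := ⟨x₀, Metric.mem_closedBall_self hR.le⟩
  have hz_cont : ContinuousOn (fun y => u y / w y) K :=
    hu.continuous.continuousOn.div hw_smooth.continuous.continuousOn fun y hy => (hw_pos y hy).ne'
  obtain ⟨ys, hys, hmax⟩ := hKc.exists_isMaxOn hKne hz_cont
  set M := u ys / w ys with hM_def
  have hdom : ∀ y ∈ K, u y ≤ M * w y := fun y hy => by
    have h1 : u y / w y ≤ M := hmax hy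
    rwa [div_le_iff₀ (hw_pos y hy)] at h1
  have huys : u ys = M * w ys := by
    rw [hM_def, div_mul_cancel₀ _ (hw_pos ys hys).ne']
  -- the maximum of the quotient is at most `8 B`
  have hMB : M ≤ 8 * B := by
    rcases (Metric.mem_closedBall.1 hys).lt_or_eq with hin | hon
    · -- interior maximiser: `M ≤ 0`
      have hMnp : M ≤ 0 := by
        have hφ_smooth : ContDiff ℝ 2 (fun y => u y - M * w y) :=
          hu.sub (contDiff_const.mul hw_smooth)
        have hφ_max : IsLocalMax (fun y => u y - M * w y) ys := by
          have hKn : K ∈ 𝓝 ys :=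
            Filter.mem_of_superset (Metric.isOpen_ball.mem_nhds (Metric.mem_ball.2 hin))
              Metric.ball_subset_closedBall
          refine Filter.eventually_of_mem hKn fun y hy => ?_
          show u y - M * w y ≤ u ys - M * w ys
          rw [huys, sub_self, sub_nonpos]
          exact hdom y hy
        have hφ_lap : (Δ fun y => u y - M * w y) ys ≤ 0 :=
          Literature.Analysis.FluidPDE.laplacian_nonpos_of_isLocalMax hφ_smooth hφ_max
        rw [laplacian_sub_const_mul hu hw_smooth, hw_lap] at hφ_lap
        have hsub' := hsub ys (Metric.mem_ball.2 hin)
        rw [huys] at hsub'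
        have hgap : 0 < 3 / R ^ 2 - lam := by
          have hlt : lam < 3 / R ^ 2 := by
            rw [lt_div_iff₀ (by positivity)]
            linarith
          linarith
        have key : M * w ys * (3 / R ^ 2 - lam) ≤ 0 := by
          have hid : M * w ys * (3 / R ^ 2 - lam) =
              ((Δ u) ys - M * (-(3 / R ^ 2) * w ys)) - ((Δ u) ys + lam * (M * w ys)) := by ring
          rw [hid]
          linarith
        by_contra hMpos
        push Not at hMpos
        have : 0 < M * w ys * (3 / R ^ 2 - lam) := mul_pos (mul_pos hMpos (hw_pos ys hys)) hgap
        linarith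
      linarith
    · -- boundary maximiser: `M w(y*) = u(y*) ≤ B` and `w(y*) ≥ 1/8`
      have hub : u ys ≤ B := hbdry ys (Metric.mem_sphere.2 hon)
      by_cases hM : M ≤ 0
      · linarith
      · push Not at hM
        have h1 : M * (1 / 8) ≤ M * w ys := mul_le_mul_of_nonneg_left (hw_lower ys hys) hM.le
        linarith
  -- conclusion at the given point of the closed ball
  have hux : u x ≤ M * w x := hdom x hx
  by_cases hM : M ≤ 0
  · have : M * w x ≤ 0 := mul_nonpos_of_nonpos_of_nonneg hM (hw_pos x hx).le
    linarith
  · push Not at hM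
    have h2 : M * w x ≤ M * 1 := mul_le_mul_of_nonneg_left (hw_le_one x) hM.le
    linarith

end Summit.AtomisticToContinuum.BoseEinsteinCondensation.Theorems
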